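import Literature.NumberTheory.EllipticCurves.GrossZagierRationalPointProofs
import Literature.NumberTheory.EllipticCurves.Castella2018.PAdicWaldspurgerFormula
import Summits.BirchSwinnertonDyer.BirchSwinnertonDyer.Theorems.CongruentShaFreeCutKatoKummerLogTorsion
import Literature.NumberTheory.QuadraticFields.ImaginaryResiduePiForm
import HarnessLib

/-!
# The Gross–Zagier descent in EXACT form (helper for crux `EulerHalfNotRamNoInertSetAtFive`, r5.4 stub S3ns)

Helper lemmas (`--supports stmt-BirchSwinnertonDyer-19715`, idea `bstw-zeta-nonsplit-door`, door skeleton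
`Cruxes/EulerHalfNotRamNoInertSetAtFive/BstwZetaNonsplitDoorSketch.lean` rev 2.1) — the classical half "B" of
that door, now importable:

* `exists_int_isOfFinAddOrder_sub_zsmul_basis` — rank-one Mordell–Weil bookkeeping over any number field:
  `R = n • B₀ + T` with `T` torsion, `ĥ(R) = n²·Reg`, `Reg = ĥ(B₀)`.
* `grossZagierDescentExact` — the tree's descent `GrossZagier1986_thm_I_7_3_main_of_isGloballyMinimal`
  (Gross–Zagier V.§2) re-run WITHOUT discarding the constant: for `E/ℚ` globally minimal of analytic rank one,
  root number `−1`, Mordell–Weil basis `x̂`, a Heegner field `L` (`d_L < −4` odd, `L(E^{(d_L)},1) ≠ 0`) with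
  Heegner point `P_L`, the Gross–Zagier formula over `L`, Birch's `√|d_L|·L(E^{(d_L)},1) = s·Ω⁻_f` and
  `c·Ω⁻_f = k·Ω⁻(E)`, there is `n ∈ ℤ ∖ {0}` with `Ш_an(E) = n²·#E(ℚ)_tors² / (2·c·s·k·∏ c_ℓ)` AND
  `2·log_ω ι_𝔭(P_L) = n·log_ω(x̂)` in `ℚ_p` for every embedding `ι_𝔭 : L → ℚ_p` (`P_L + P̄_L = n·x̂ +` torsion,
  `P̄_L = −w·P_L +` torsion with `w = −1` by Darmon Prop. 3.11, `ĥ_L(R) = 2·ĥ_ℚ(R)`, `#𝓞_L^× = 2`).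

No summit statement, crux or registered stub is proved here; this is descent bookkeeping from tree theorems.
-/

noncomputable section

open scoped Classical

set_option linter.dupNamespace false

namespace Summit.BirchSwinnertonDyer.BirchSwinnertonDyer.Theorems.GrossZagierDescentExact

open Literature.NumberTheory.EllipticCurves Literature.NumberTheory.EllipticCurves.Kato2004
open Literature.NumberTheory.EllipticCurves.ModularForms
open Literature.NumberTheory.EllipticCurves.Castella2018
open Summit.BirchSwinnertonDyer.Rank1Residual

/-- **Rank one bookkeeping** (any number field `K`): for a Mordell–Weil basis `B` of `E(K)/tors`
indexed by `Fin (rank E(K))` with `rank E(K) = 1` and any `R ∈ E(K)`, `R = n • B₀ + T` with `T`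
torsion, `ĥ(R) = n² · Reg(E/K)` and `Reg(E/K) = ĥ(B₀)` (`IsMordellWeilBasis.regulatorOf_eq_regulator`,
`heightPairing_self_holds`, `canonicalHeight_zsmul_holds`; the tree's
`exists_int_canonicalHeight_eq_sq_mul_regulator` with the basis and the torsion difference exposed).
[cite: SilvermanAEC2009, Thm. VIII.9.3] [cite: GrossZagier1986, I.(7.2)–(7.3) (p. 231)] -/
theorem exists_int_isOfFinAddOrder_sub_zsmul_basis {K : Type*} [Field K] [NumberField K]
    (V : WeierstrassCurve K) [V.IsElliptic] (h1 : V.mordellWeilRank = 1)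
    (B : Fin V.mordellWeilRank → V.toAffine.Point) (hB : V.IsMordellWeilBasis B)
    (R : V.toAffine.Point) :
    ∃ n : ℤ, IsOfFinAddOrder (R - n • B (Fin.cast h1.symm 0)) ∧
      R.canonicalHeight = (n : ℝ) ^ 2 * V.regulator ∧
      (B (Fin.cast h1.symm 0)).canonicalHeight = V.regulator := by
  have hidx : ∀ i : Fin V.mordellWeilRank, i = Fin.cast h1.symm 0 := fun i =>
    Fin.ext (by simp only [Fin.val_cast, Fin.val_zero]; have := i.2; omega)
  haveI : Subsingleton (Fin V.mordellWeilRank) := ⟨fun a b => (hidx a).trans (hidx b).symm⟩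
  have hreg : V.regulator = (B (Fin.cast h1.symm 0)).canonicalHeight := by
    rw [← hB.regulatorOf_eq_regulator, WeierstrassCurve.regulatorOf,
      Matrix.det_eq_elem_of_subsingleton _ (Fin.cast h1.symm 0),
      WeierstrassCurve.heightPairingMatrix_apply,
      WeierstrassCurve.Affine.Point.heightPairing_self_holds]
  have hmem : (QuotientAddGroup.mk R : WeierstrassCurve.mordellWeilModTorsion V) ∈
      Submodule.span ℤ (Set.range
        (QuotientAddGroup.mk ∘ B : Fin V.mordellWeilRank → WeierstrassCurve.mordellWeilModTorsion V)) := by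
    rw [hB.2]; exact Submodule.mem_top
  obtain ⟨c, hc⟩ := (Submodule.mem_span_range_iff_exists_fun ℤ).mp hmem
  rw [Fintype.sum_eq_single (Fin.cast h1.symm 0) (fun j hj => absurd (hidx j) hj)] at hc
  set n : ℤ := c (Fin.cast h1.symm 0) with hn
  have hTn : IsOfFinAddOrder (R - n • B (Fin.cast h1.symm 0)) := by
    rw [← AddCommGroup.mem_torsion, ← QuotientAddGroup.eq_zero_iff, QuotientAddGroup.mk_sub,
      QuotientAddGroup.mk_zsmul, sub_eq_zero]
    exact hc.symm
  refine ⟨n, hTn, ?_, hreg.symm⟩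
  have hRdec : R = n • B (Fin.cast h1.symm 0) + (R - n • B (Fin.cast h1.symm 0)) := by abel
  rw [hRdec, canonicalHeight_add_of_isOfFinAddOrder _ hTn,
    WeierstrassCurve.Affine.Point.canonicalHeight_zsmul_holds, hreg]

/-- **B — the Gross–Zagier descent in EXACT form** (classical; proved by re-running the tree proof of
`GrossZagier1986_thm_I_7_3_main_of_isGloballyMinimal` without discarding the constant, plus the `p`-adic
logarithm bookkeeping `log(P_L + P̄_L) = 2 log ι_𝔭 P_L`, `log(n x̂ + T) = n log x̂`).  For `E = W` globally
minimal of analytic rank one and root number `−1`, a Mordell–Weil basis `x̂` (rank one), an imaginary quadratic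
`L` with the Heegner hypothesis for `N_E`, `d_L < −4` odd and `L(E^{(d_L)},1) ≠ 0`, a Heegner point `P_L` of the
datum `(Dt, Hd, ι∞)`, the Gross–Zagier formula over `L`, Birch's `√|d_L|·L(E^{(d_L)},1) = s·Ω⁻_f` and the period
relation `c·Ω⁻_f = k·Ω⁻(E)`: there is `n ∈ ℤ ∖ {0}` (`P_L + P̄_L ≡ n·x̂ mod torsion`) with
`Ш_an(E) = n²·#E(ℚ)_tors² / (2·c·s·k·∏ c_ℓ)` and `2·log_ω ι_𝔭(P_L) = n·log_ω(x̂)` for every `ι_𝔭 : L → ℚ_p`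
(`#𝓞_L^× = 2` as `d_L < −4`; `ĥ(n x̂ + T) = n² Reg`; `P̄_L = P_L +` torsion by Darmon Prop. 3.11 with `w = −1`).
[cite: GrossZagier1986, Thm. I.(7.3) and V.§2 (pp. 312–313)] [cite: Darmon2004, Prop. 3.11] -/
theorem grossZagierDescentExact :
    ∀ (W : WeierstrassCurve ℚ) [W.IsElliptic] [W.IsGloballyMinimal] (p : ℕ) [Fact p.Prime]
      [NeZero (W.conductorNorm ℤ)],
      exists_isNewformOf → W.analyticRank = 1 → W.rootNumber = -1 →
      ∀ (h1 : W.mordellWeilRank = 1) (P : Fin W.mordellWeilRank → W.toAffine.Point), W.IsMordellWeilBasis P →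
      ∀ (L : Type) [Field L] [NumberField L], IsImaginaryQuadratic L →
        SatisfiesHeegnerHypothesis (W.conductorNorm ℤ) L → NumberField.discr L < -4 → Odd (NumberField.discr L) →
        (W.quadraticTwist (NumberField.discr L : ℚ)).entireLFunction 1 ≠ 0 →
      ∀ (Dt : ModularParametrizationData W (W.conductorNorm ℤ))
        (Hd : HeegnerDatum (W.conductorNorm ℤ) (NumberField.discr L)) (ι : L →+* ℂ)
        (PL : (W.baseChange L).toAffine.Point),
        WeierstrassCurve.Affine.Point.map ι.toRatAlgHom PL = heegnerPointComplex Dt Hd →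
        GrossZagierFormula (W.conductorNorm ℤ) W L →
      ∀ (s : ℚ) (k : ℤ),
        (Real.sqrt ((NumberField.discr L).natAbs : ℝ) : ℂ) *
            (W.quadraticTwist (NumberField.discr L : ℚ)).entireLFunction 1 = (s : ℂ) * (minusPeriod Dt.f : ℂ) →
        (Dt.c : ℝ) * minusPeriod Dt.f = k * W.imaginaryPeriodRat →
      ∀ (ιp : L →+* ℚ_[p]),
      ∃ n : ℤ, n ≠ 0 ∧
        shaAn W = (((n : ℚ) ^ 2 * (W.torsionOrder : ℚ) ^ 2 /
            (2 * (Dt.c : ℚ) * s * (k : ℚ) * (W.tamagawaProduct : ℚ)) : ℚ) : ℂ) ∧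
        (2 : ℚ_[p]) * padicLogOmega W p ιp PL = (n : ℚ_[p]) * padicLogLocal W p
            (WeierstrassCurve.Affine.Point.map (W' := W) (Algebra.ofId ℚ ℚ_[p]) (P (Fin.cast h1.symm 0))) := by
  intro W _ _ p _ _ hmod hr hw h1 P hP L _ _ hLq hH hd4 hodd hLt Dt Hd ι PL hPL eGZ s k hs hk ιp
  have hE : WeierstrassCurve.hasEntireLFunction_rat :=
    WeierstrassCurve.hasEntireLFunction_rat_of_exists_isNewformOf hmod
  have hdneg : NumberField.discr L < 0 := IsImaginaryQuadratic.discr_neg hLq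
  have hdq : (NumberField.discr L : ℚ) ≠ 0 := by exact_mod_cast hdneg.ne
  haveI := W.isElliptic_quadraticTwist hdq
  haveI : (W.baseChange L).IsElliptic := by rw [WeierstrassCurve.baseChange]; infer_instance
  -- (1) `L(E,1) = 0`, `L'(E,1) = leadingLCoeff ≠ 0`, the product rule and Gross–Zagier over `L`
  have h0 : W.entireLFunction 1 = 0 := entireLFunction_one_eq_zero_of_analyticRank_eq_one (W := W) hr
  obtain ⟨hlead, hL1⟩ := leadingLCoeff_eq_deriv_of_analyticRank_eq_one (W := W) hr
  have hGZ := eGZ Dt Hd ι PL hPL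
  have hprod := lDerivEK_eq_deriv_mul_of_entireLFunction_one_eq_zero hE W L h0
  have hu : NumberField.Units.torsionOrder L = 2 :=
    Literature.NumberTheory.QuadraticFields.Quadratic.torsionOrder_eq_two_of_discr_lt_neg_four hLq.1 hd4
  have hcov := Dt.realPeriodRat_mul_imaginaryPeriodRat_eq_two_mul_covolume
  -- (2) the reflection `σ` and Darmon's Prop. 3.11 (`w = -1`): `σ P_L − P_L` is torsion
  obtain ⟨θ, cθ, hθ, hcθ⟩ :=
    Literature.NumberTheory.QuadraticFields.Quadratic.exists_sq_eq_algebraMap (F := ℚ) (K := L) hLq.1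
  have hσ : Literature.NumberTheory.QuadraticFields.Quadratic.conj hLq.1 hθ hcθ ≠ AlgHom.id ℚ L := by
    intro hid
    have h1' : Literature.NumberTheory.QuadraticFields.Quadratic.conj hLq.1 hθ hcθ θ = -θ :=
      Literature.NumberTheory.QuadraticFields.Quadratic.conj_gen hLq.1 hθ hcθ
    rw [hid, AlgHom.id_apply] at h1'
    have h2θ : (2 : L) * θ = 0 := by linear_combination h1'
    exact Literature.NumberTheory.QuadraticFields.Quadratic.ne_zero_of_not_mem_range hθ
      ((mul_eq_zero.mp h2θ).resolve_left two_ne_zero)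
  set σ := Literature.NumberTheory.QuadraticFields.Quadratic.conj hLq.1 hθ hcθ with hσdef
  have hT := heegnerPoint_conj_add_rootNumber_smul_holds W L hLq hH ⟨Dt, Hd, ι, hPL⟩ _ hσ
  rw [hw, neg_one_zsmul, ← sub_eq_add_neg] at hT
  -- (3) the descended point `R ∈ E(ℚ)` with `ι R = P_L + σ P_L`, `ĥ(R) = 2 ĥ(P_L)`
  have hσσ : ∀ z, σ (σ z) = z :=
    Literature.NumberTheory.EllipticCurves.Quadratic.apply_apply_of_ne_id hLq.1 hσ
  set Q := PL + WeierstrassCurve.QuadraticDescent.conjMap W σ PL with hQ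
  have hQfix : WeierstrassCurve.QuadraticDescent.conjMap W σ Q = Q := by
    rw [hQ, map_add, WeierstrassCurve.QuadraticDescent.conjMap_conjMap W hσσ, add_comm]
  obtain ⟨R, hR⟩ := WeierstrassCurve.QuadraticDescent.exists_incl_eq_of_conjMap_eq hLq.1 W hσ hQfix
  have hQ' : Q = (2 : ℕ) • PL + (WeierstrassCurve.QuadraticDescent.conjMap W σ PL - PL) := by rw [hQ, two_nsmul]; abel
  have hhQ : Q.canonicalHeight = 4 * PL.canonicalHeight := by
    rw [hQ', canonicalHeight_add_of_isOfFinAddOrder _ hT,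
      WeierstrassCurve.Affine.Point.canonicalHeight_nsmul_holds]
    norm_num
  have hhR : R.canonicalHeight = 2 * PL.canonicalHeight := by
    have hbc : (WeierstrassCurve.QuadraticDescent.incl L W R).canonicalHeight = 2 * R.canonicalHeight := by
      have h := WeierstrassCurve.Affine.Point.canonicalHeight_baseChange (W := W) (K := ℚ) (L := L) R
      rw [hLq.1] at h
      convert h using 2 <;> rfl
    have : 2 * R.canonicalHeight = 4 * PL.canonicalHeight := by rw [← hbc, hR, hhQ]
    linarith
  -- (4) `R = n • x̂ + T` with `T` torsion, `ĥ(R) = n² Reg` (rank one, the basis `P`)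
  obtain ⟨n, hTn, hhRn, hreg⟩ := exists_int_isOfFinAddOrder_sub_zsmul_basis W h1 P hP R
  set x := P (Fin.cast h1.symm 0) with hx
  -- (5) non-vanishing bookkeeping
  have hreg0 : 0 < W.regulator := W.regulator_pos'
  have hΩ : 0 < W.realPeriodRat := W.realPeriodRat_pos_holds
  have hΩm : 0 < W.imaginaryPeriodRat := W.imaginaryPeriodRat_pos
  have hc0 : (Dt.c : ℝ) ≠ 0 := Int.cast_ne_zero.mpr Dt.maninConstant_ne_zero_holds
  have hΩf : 0 < minusPeriod Dt.f :=
    IsNewform0.minusPeriod_pos_holds Dt.isNewformOf.1 Dt.isNewformOf.coeffField_eq_bot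
  have hkR : (k : ℝ) ≠ 0 := by
    intro hk0
    rw [hk0, zero_mul] at hk
    exact (mul_ne_zero hc0 hΩf.ne') hk
  have hsD : 0 < Real.sqrt ((NumberField.discr L).natAbs : ℝ) :=
    Real.sqrt_pos.mpr (by exact_mod_cast Int.natAbs_pos.mpr hdneg.ne)
  have hs0 : s ≠ 0 := by
    rintro rfl
    rw [Rat.cast_zero, zero_mul, mul_eq_zero] at hs
    rcases hs with h | h
    · exact hsD.ne' (by exact_mod_cast h)
    · exact hLt h
  have hsR : (s : ℝ) ≠ 0 := Rat.cast_ne_zero.mpr hs0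
  have htors : (0 : ℝ) < W.torsionOrder := by exact_mod_cast W.torsionOrder_pos_holds
  have hTam : (0 : ℝ) < W.tamagawaProduct := by exact_mod_cast W.tamagawaProduct_pos'
  have hsqabs : Real.sqrt ((NumberField.discr L).natAbs : ℝ) = Real.sqrt |(NumberField.discr L : ℝ)| := by
    congr 1; rw [Nat.cast_natAbs, Int.cast_abs]
  -- (6) `L'(E,1)` in closed form; `n ≠ 0`
  have hPLh : PL.canonicalHeight ≠ 0 := by
    intro hz
    have : LDerivEK W L = 0 := by rw [hGZ, hz, mul_zero, Complex.ofReal_zero]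
    rw [hprod] at this
    exact (mul_ne_zero hL1 hLt) this
  have hn0 : n ≠ 0 := by
    rintro hnz
    rw [hnz, Int.cast_zero, zero_pow two_ne_zero, zero_mul] at hhRn
    exact hPLh (by linarith [hhR, hhRn])
  rw [hsqabs] at hs hsD
  have hLd : (W.quadraticTwist (NumberField.discr L : ℚ)).entireLFunction 1 =
      (((s : ℝ) * minusPeriod Dt.f / Real.sqrt |(NumberField.discr L : ℝ)| : ℝ) : ℂ) := by
    have hsDC : (Real.sqrt |(NumberField.discr L : ℝ)| : ℂ) ≠ 0 := Complex.ofReal_ne_zero.mpr hsD.ne'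
    rw [Complex.ofReal_div, eq_div_iff hsDC]
    push_cast
    linear_combination hs
  have hL' : deriv W.entireLFunction 1 =
      (((2 * ZLattice.covolume Dt.L.lattice /
          ((Dt.c : ℝ) ^ 2 * ((NumberField.Units.torsionOrder L : ℝ) / 2) ^ 2 *
            Real.sqrt |(NumberField.discr L : ℝ)|) *
          PL.canonicalHeight) / ((s : ℝ) * minusPeriod Dt.f / Real.sqrt |(NumberField.discr L : ℝ)|) : ℝ) : ℂ) := by
    rw [Complex.ofReal_div, ← hLd, ← hGZ, hprod, mul_div_cancel_right₀ _ hLt]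
  refine ⟨n, hn0, ?_, ?_⟩
  · -- `Ш_an = L'(E,1) #tors² / (Ω Tam Reg)` with `L'(E,1) = Ω ĥ(R)/(2 c s k)`, `ĥ(R) = n² Reg`
    rw [shaAn_def, hlead, hL']
    have hΩf' : minusPeriod Dt.f = k * W.imaginaryPeriodRat / Dt.c := by
      rw [eq_div_iff hc0]; linarith [hk]
    have hcov' : ZLattice.covolume Dt.L.lattice = W.realPeriodRat * W.imaginaryPeriodRat / 2 := by
      linarith [hcov]
    have hPL2 : PL.canonicalHeight = (n : ℝ) ^ 2 * W.regulator / 2 := by linarith [hhR, hhRn]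
    have hsq0 : Real.sqrt |(NumberField.discr L : ℝ)| ≠ 0 := hsD.ne'
    have hΩC : (W.realPeriodRat : ℂ) ≠ 0 := Complex.ofReal_ne_zero.mpr hΩ.ne'
    have hΩmC : (W.imaginaryPeriodRat : ℂ) ≠ 0 := Complex.ofReal_ne_zero.mpr hΩm.ne'
    have hsqC : ((Real.sqrt |(NumberField.discr L : ℝ)| : ℝ) : ℂ) ≠ 0 := Complex.ofReal_ne_zero.mpr hsq0
    have hregC : (W.regulator : ℂ) ≠ 0 := Complex.ofReal_ne_zero.mpr hreg0.ne'
    have hcC : (Dt.c : ℂ) ≠ 0 := by exact_mod_cast Dt.maninConstant_ne_zero_holds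
    have hk0 : k ≠ 0 := by rintro rfl; exact hkR (by simp)
    have hkC : (k : ℂ) ≠ 0 := by exact_mod_cast hk0
    have hsC : (s : ℂ) ≠ 0 := by exact_mod_cast hs0
    have hTamC : (W.tamagawaProduct : ℂ) ≠ 0 := by exact_mod_cast W.tamagawaProduct_pos'.ne'
    rw [hΩf', hcov', hPL2, hu]
    push_cast
    field_simp
  · -- `2 log ι P_L = n log x̂`: `ι_* R = (P_L + σ P_L)_ι`, `σ P_L − P_L` and `R − n x̂` torsion
    have key : ∀ Q' : (W.baseChange ℚ_[p]).toAffine.Point, padicLogLocal W p Q' =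
        Additive.LocalLog.padicLog (W.baseChange ℚ_[p]) Q' :=
      Summit.BirchSwinnertonDyer.BirchSwinnertonDyer.Theorems.CongruentShaFreeCutKatoKummerLogTorsion.padicLogLocal_eq_padicLog
        W p
    have ePL : padicLogOmega W p ιp PL =
        padicLogLocal W p (WeierstrassCurve.Affine.Point.map (W' := W) ιp.toRatAlgHom PL) := rfl
    -- `incl L W R` is Mathlib's `map (ofId ℚ L) R` (the generic `incl` carries the classical
    -- `DecidableEq ℚ`, the fresh term `instDecidableEqRat`; the underlying functions agree by `rfl`)
    have hRQ : WeierstrassCurve.Affine.Point.map (W' := W) (Algebra.ofId ℚ L) R = Q := hR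
    -- `E(ℚ) → E(ℚ_p)` as a homomorphism OUT OF `W.toAffine.Point` (the type ascription fixes the domain, so that
    -- `map_sub` / `map_zsmul` rewrite without crossing `W` vs `W.baseChange ℚ`)
    set φ : W.toAffine.Point →+ (W.baseChange ℚ_[p]).toAffine.Point :=
      WeierstrassCurve.Affine.Point.map (W' := W.toAffine) (S := ℚ) (Algebra.ofId ℚ ℚ_[p]) with hφ
    have h2 : WeierstrassCurve.Affine.Point.map (W' := W) ιp.toRatAlgHom Q =
        WeierstrassCurve.Affine.Point.map (W' := W) (Algebra.ofId ℚ ℚ_[p]) R := by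
      -- `ι_p ∘ (ℚ ⊂ L) = (ℚ ⊂ ℚ_p)` on points (Mathlib `map_map`, `ℚ →ₐ[ℚ] ℚ_p` is a subsingleton)
      rw [← hRQ, WeierstrassCurve.Affine.Point.map_map,
        Subsingleton.elim (ιp.toRatAlgHom.comp (Algebra.ofId ℚ L)) (Algebra.ofId ℚ ℚ_[p])]
    have hmapR : φ R = WeierstrassCurve.Affine.Point.map (W' := W) ιp.toRatAlgHom Q :=
      (congrArg (fun g : W.toAffine.Point →+ (W.baseChange ℚ_[p]).toAffine.Point => g R) hφ).trans h2.symm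
    have hTι : IsOfFinAddOrder
        (WeierstrassCurve.Affine.Point.map (W' := W) ιp.toRatAlgHom (WeierstrassCurve.QuadraticDescent.conjMap W σ PL - PL)) :=
      (WeierstrassCurve.Affine.Point.map (W' := W) ιp.toRatAlgHom).isOfFinAddOrder hT
    have hTn' : IsOfFinAddOrder (R - n • x) := by
      -- same point, `instDecidableEqRat` vs the classical `DecidableEq ℚ` of the generic lemma
      convert hTn
    have hTx : IsOfFinAddOrder (φ (R - n • x)) := φ.isOfFinAddOrder hTn'
    have hRloc : φ R = n • φ x + φ (R - n • x) := by rw [map_sub, map_zsmul]; abel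
    calc (2 : ℚ_[p]) * padicLogOmega W p ιp PL
        = Additive.LocalLog.padicLog (W.baseChange ℚ_[p])
            (WeierstrassCurve.Affine.Point.map (W' := W) ιp.toRatAlgHom ((2 : ℕ) • PL)) := by
          rw [ePL, key, map_nsmul, map_nsmul, nsmul_eq_mul, Nat.cast_ofNat]
      _ = Additive.LocalLog.padicLog (W.baseChange ℚ_[p])
            (WeierstrassCurve.Affine.Point.map (W' := W) ιp.toRatAlgHom Q) := by
          rw [hQ', map_add, map_add, (Additive.LocalLog.padicLog_eq_zero_iff _ _).mpr hTι, add_zero]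
      _ = Additive.LocalLog.padicLog (W.baseChange ℚ_[p]) (φ R) := by rw [hmapR]
      _ = (n : ℚ_[p]) * padicLogLocal W p (φ x) := by
          rw [hRloc, map_add, (Additive.LocalLog.padicLog_eq_zero_iff _ _).mpr hTx, add_zero,
            map_zsmul, zsmul_eq_mul, key]

end Summit.BirchSwinnertonDyer.BirchSwinnertonDyer.Theorems.GrossZagierDescentExact
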